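import Summits.AtomisticToContinuum.Crystallization.Theorems.FrustratedLawDichotomyGSCVanHoveBalls

/-!
# FrustratedLawDichotomy · crux `AperiodicFrustratedLawGap` (stmt-AtomisticToContinuum-27623) — NO FINITE CONFIGURATION IS A μ-EQUILIBRIUM OF
# LENNARD-JONES, AT ANY CHEMICAL POTENTIAL (decomp-a2c, prover hand 2, structural share, generation 7; route-independent module)

Completion of `FrustratedLawDichotomyGSCVanHoveBalls.not_isMuGSC_eStar_of_finite` (the case `μ = e⋆`, via strict periodisation): for EVERY
`μ ∈ ℝ`, a finite non-empty `X ⊆ ℝ³` is not a `μ`GSC of `V_LJ`.  Removing everything costs at most `μ·n`, so `U(X) ≤ μ·n`; replacing `X` by two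
far copies of itself must not pay, so `U(X) − μ·n ≤ U(two copies) − 2μ·n < 2U(X) − 2μ·n` (the copies attract: `interactionEnergy_copiesFin_two_lt`),
i.e. `μ·n < U(X)` — contradiction.  Hence every exact μ-equilibrium met in the crux's residuals is infinite, whatever `μ` (the `e⋆`-free van
Hove forms of generation 6 quantify over all `μc`).  `[folklore]`.
-/

noncomputable section

namespace Summit.AtomisticToContinuum.Crystallization.Theorems.FrustratedLawDichotomyGSCNoFiniteEquilibria

open Literature.MathematicalPhysics.StatisticalMechanics
open Summit.AtomisticToContinuum.Crystallization.Theorems.ChargedEnergyGapNegative (E3 Dsum Dsum_nonneg copiesFin copiesFin_injective)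
open Summit.AtomisticToContinuum.Crystallization.Theorems.FrustratedLawDichotomyFiniteClusterGap (interactionEnergy_copiesFin_two_lt)
open Summit.AtomisticToContinuum.Crystallization.Theorems.FrustratedLawDichotomyGSCClusterExactness (interactionEnergy_le_of_isMuGSC)

variable {X : Set E3}

/-- **No finite non-empty configuration is a `μ`GSC of `V_LJ`, for any `μ`.** [folklore] -/
theorem not_isMuGSC_of_finite_nonempty (μ : ℝ) (hfin : X.Finite) (hne : X.Nonempty) : ¬ IsMuGSC lennardJones μ X := by
  intro h
  obtain ⟨n, f, hf⟩ := hfin.fin_embedding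
  have hn : 0 < n := by
    obtain ⟨p, hp⟩ := hne
    rw [← hf] at hp
    obtain ⟨i, -⟩ := hp
    exact Fin.pos i
  have hempty : X \ Set.range f = ∅ := by rw [hf, Set.sdiff_self]
  haveI : IsEmpty ↥(X \ Set.range f) := by rw [hempty]; exact Set.isEmpty_coe_sort.2 rfl
  -- removal of everything: `U(X) ≤ μ·n`
  have hle := interactionEnergy_le_of_isMuGSC h f.injective hf.le
  have h0 : ∑ i, ∑' y : ↥(X \ Set.range f), lennardJones (dist (f i) y) = 0 :=
    Finset.sum_eq_zero fun i _ => tsum_empty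
  rw [h0, sub_zero] at hle
  -- replacement by two far copies
  set L : ℝ := 2 * Dsum ⇑f + 2 with hL
  have hL1 : 1 < L - 2 * Dsum ⇑f := by rw [hL]; linarith
  have hL2 : 2 * Dsum ⇑f < L := by rw [hL]; linarith
  have hinjR := copiesFin_injective 2 hL2 f.injective
  have hdisj : Disjoint (Set.range (copiesFin 2 L ⇑f)) (X \ Set.range f) := by
    rw [hempty]; exact Set.disjoint_empty _
  have key := h.le f.injective hf.le hinjR hdisj
  have h0' : ∑ i, ∑' y : ↥(X \ Set.range f), lennardJones (dist (copiesFin 2 L ⇑f i) y) = 0 :=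
    Finset.sum_eq_zero fun i _ => tsum_empty
  rw [h0, h0'] at key
  have hlt := interactionEnergy_copiesFin_two_lt hn ⇑f hL1
  push_cast at key
  nlinarith

/-- **Exact μ-equilibria are infinite, at every `μ`.** [folklore] -/
theorem infinite_of_isMuGSC {μ : ℝ} (h : IsMuGSC lennardJones μ X) (hne : X.Nonempty) : X.Infinite :=
  fun hfin => not_isMuGSC_of_finite_nonempty μ hfin hne h

end Summit.AtomisticToContinuum.Crystallization.Theorems.FrustratedLawDichotomyGSCNoFiniteEquilibria

end
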